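import Summits.RiemannHypothesis.RiemannHypothesis.Theorems.SemilocalPolyWitness
import HarnessLib

/-!
# The increment identity for ANY polynomial window (non-odd variant)

Cell `rh-explicit` (HOME `run/shared/lean/pub/rh-explicit/`), seat cc-s2-4 gen3, LEAD RULING R7-13 ("hand the increment /
kappa list lemmas, non-odd variant, to cc-s2-3 for PHASE-2 P5").  `SemilocalPolyWitness.lean` proves the increment identity
`D_t(G) = 2‖G‖² − 2κ(t) = ev (incrementL p b) t` on `[0, 2b]` for ODD polynomial windows `G = p·1_{[−b,b]}` only, because
its integrability step went through `IsMarkovWitness` (which carries oddness).  Oddness is not needed for the identity: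
this file re-derives the `L²` integrability of `g²` from boundedness + compact support and restates the four increment
theorems WITHOUT the `isOddList` hypothesis (same `kappaL`, `incrementL`, `LQ.normSq` — pure data reuse).
-/

set_option linter.dupNamespace false

open MeasureTheory Set Filter Topology Real Finset
open Literature.NumberTheory.LFunctions
open Summit.RiemannHypothesis.RiemannHypothesis.Theorems.MotivicDoor

namespace Summit.RiemannHypothesis.RiemannHypothesis.Theorems.SemilocalPolyWitness

open LQ

variable {p : List ℚ} {b : ℚ}

/-- `x ↦ g(x)²` is integrable for EVERY polynomial window (bounded by `absBound² `, vanishing off `[−b, b]`). -/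
theorem integrable_polyWitnessRe_sq' (hb : 0 < b) : Integrable fun x ↦ polyWitnessRe p b x ^ 2 := by
  have hb' : (0 : ℝ) < b := by exact_mod_cast hb
  refine SemilocalMarkov.integrable_of_norm_le_of_eq_zero (C := (absBound p b : ℝ) ^ 2) (R := b)
    ((measurable_polyWitnessRe (p := p) (b := b)).pow_const 2).aestronglyMeasurable (fun x ↦ ?_) (fun x hx ↦ ?_)
  · rw [Real.norm_eq_abs, abs_pow, sq_abs, ← sq_abs]
    exact pow_le_pow_left₀ (abs_nonneg _) (abs_polyWitnessRe_le hb x) 2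
  · have hx' : x ∉ Icc (-(b : ℝ)) b := fun h ↦ by
      rw [Set.mem_Icc] at h
      have := abs_le.2 ⟨by linarith [h.1], h.2⟩
      linarith
    rw [polyWitnessRe_of_not_mem hx']; ring

/-- Polarisation, any polynomial window: `D_t(G) = 2‖G‖² − 2 ∫ g(x+t) g(x) dx`. -/
theorem weilIncrement_polyWitness' (hb : 0 < b) (t : ℝ) :
    weilIncrement (polyWitness p b) t
      = 2 * (LQ.normSq p b : ℝ) - 2 * ∫ x, polyWitnessRe p b (x + t) * polyWitnessRe p b x := by
  unfold weilIncrement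
  have e : ∀ x, ‖polyWitness p b (x + t) - polyWitness p b x‖ ^ 2
      = polyWitnessRe p b (x + t) ^ 2 + polyWitnessRe p b x ^ 2
          - 2 * (polyWitnessRe p b (x + t) * polyWitnessRe p b x) := fun x ↦ by
    rw [polyWitness, polyWitness, ← Complex.ofReal_sub, Complex.norm_real, Real.norm_eq_abs, sq_abs]; ring
  simp_rw [e]
  have h2 := integrable_polyWitnessRe_sq' (p := p) hb
  have h1 : Integrable fun x ↦ polyWitnessRe p b (x + t) ^ 2 := h2.comp_add_right t
  have h3 := integrable_polyWitnessRe_shift_mul (p := p) hb t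
  have h12 : Integrable fun x ↦ polyWitnessRe p b (x + t) ^ 2 + polyWitnessRe p b x ^ 2 := h1.add h2
  have h3' : Integrable fun x ↦ 2 * (polyWitnessRe p b (x + t) * polyWitnessRe p b x) := h3.const_mul 2
  rw [integral_sub h12 h3', integral_add h1 h2, integral_const_mul,
    integral_add_right_eq_self (fun x ↦ polyWitnessRe p b x ^ 2) t, integral_polyWitnessRe_sq hb]
  ring

/-- **INCREMENT IDENTITY, any polynomial window**: `D_t(G) = 2‖G‖² − 2κ(t)`, `κ = ev (kappaL p b)`, `0 ≤ t ≤ 2b`. -/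
theorem weilIncrement_polyWitness_eq' (hb : 0 < b) {t : ℝ} (ht0 : 0 ≤ t) (ht : t ≤ 2 * b) :
    weilIncrement (polyWitness p b) t = 2 * (LQ.normSq p b : ℝ) - 2 * ev (kappaL p b) t := by
  rw [weilIncrement_polyWitness' hb, integral_polyWitnessRe_shift_mul ht0 ht]

/-- `D_t(G) = 2‖G‖²` for `t > 2b`, any polynomial window. -/
theorem weilIncrement_polyWitness_eq_of_lt' (hb : 0 < b) {t : ℝ} (ht : 2 * (b : ℝ) < t) :
    weilIncrement (polyWitness p b) t = 2 * (LQ.normSq p b : ℝ) := by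
  rw [weilIncrement_polyWitness' hb, integral_polyWitnessRe_shift_mul_of_lt ht]; ring

/-- **INCREMENT IDENTITY, list form, any polynomial window**: `D_t(G) = ev (incrementL p b) t` on `[0, 2b]`. -/
theorem weilIncrement_polyWitness_eq_ev' (hb : 0 < b) {t : ℝ} (ht0 : 0 ≤ t) (ht : t ≤ 2 * b) :
    weilIncrement (polyWitness p b) t = ev (incrementL p b) t := by
  rw [ev_incrementL, weilIncrement_polyWitness_eq' hb ht0 ht]

/-- `‖G‖²` is integrable for any polynomial window (convenience for users of the identity). -/
theorem integrable_norm_sq_polyWitness' (hb : 0 < b) : Integrable fun x ↦ ‖polyWitness p b x‖ ^ 2 :=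
  (integrable_polyWitnessRe_sq' (p := p) hb).congr (Eventually.of_forall fun x ↦ by
    simp only [norm_polyWitness, sq_abs])

end Summit.RiemannHypothesis.RiemannHypothesis.Theorems.SemilocalPolyWitness
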